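import Summits.RiemannHypothesis.RiemannHypothesis.Theorems.WeilTwoPrimeDeflC83XDef
import Summits.RiemannHypothesis.RiemannHypothesis.Theorems.WeilTwoPrimeDeflC83XDataPO30
import Literature.NumberTheory.LFunctions.WeilBlockRowsR
import HarnessLib

/-!
# Deflated two-prime certificate C83X: the materialized odd block agrees with `P_r + Σ μ ĉ ĉᵀ`, rows 16–31

`WeilCert.checkPmRowG` for certificate C83X (odd block), by `decide +kernel`. Pure proof file; nothing is asserted.
-/

set_option linter.dupNamespace false

noncomputable section

namespace Summit.RiemannHypothesis.RiemannHypothesis.Theorems.EvenWinsBeyondArch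

open Literature.NumberTheory.LFunctions

set_option maxHeartbeats 0 in
/-- Row 16 of the materialized odd block is row 16 of `P_r + Σ μ ĉ ĉᵀ` (certificate C83X). [folklore] -/
theorem checkPmRowG1_16_weilCertDeflC83X : weilCertDeflC83XBase.checkPmRowG weilCertDeflC83XP weilCertDeflC83XPmO 1 16 = true := by
  decide +kernel

set_option maxHeartbeats 0 in
/-- Row 17 of the materialized odd block is row 17 of `P_r + Σ μ ĉ ĉᵀ` (certificate C83X). [folklore] -/
theorem checkPmRowG1_17_weilCertDeflC83X : weilCertDeflC83XBase.checkPmRowG weilCertDeflC83XP weilCertDeflC83XPmO 1 17 = true := by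
  decide +kernel

set_option maxHeartbeats 0 in
/-- Row 18 of the materialized odd block is row 18 of `P_r + Σ μ ĉ ĉᵀ` (certificate C83X). [folklore] -/
theorem checkPmRowG1_18_weilCertDeflC83X : weilCertDeflC83XBase.checkPmRowG weilCertDeflC83XP weilCertDeflC83XPmO 1 18 = true := by
  decide +kernel

set_option maxHeartbeats 0 in
/-- Row 19 of the materialized odd block is row 19 of `P_r + Σ μ ĉ ĉᵀ` (certificate C83X). [folklore] -/
theorem checkPmRowG1_19_weilCertDeflC83X : weilCertDeflC83XBase.checkPmRowG weilCertDeflC83XP weilCertDeflC83XPmO 1 19 = true := by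
  decide +kernel

set_option maxHeartbeats 0 in
/-- Row 20 of the materialized odd block is row 20 of `P_r + Σ μ ĉ ĉᵀ` (certificate C83X). [folklore] -/
theorem checkPmRowG1_20_weilCertDeflC83X : weilCertDeflC83XBase.checkPmRowG weilCertDeflC83XP weilCertDeflC83XPmO 1 20 = true := by
  decide +kernel

set_option maxHeartbeats 0 in
/-- Row 21 of the materialized odd block is row 21 of `P_r + Σ μ ĉ ĉᵀ` (certificate C83X). [folklore] -/
theorem checkPmRowG1_21_weilCertDeflC83X : weilCertDeflC83XBase.checkPmRowG weilCertDeflC83XP weilCertDeflC83XPmO 1 21 = true := by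
  decide +kernel

set_option maxHeartbeats 0 in
/-- Row 22 of the materialized odd block is row 22 of `P_r + Σ μ ĉ ĉᵀ` (certificate C83X). [folklore] -/
theorem checkPmRowG1_22_weilCertDeflC83X : weilCertDeflC83XBase.checkPmRowG weilCertDeflC83XP weilCertDeflC83XPmO 1 22 = true := by
  decide +kernel

set_option maxHeartbeats 0 in
/-- Row 23 of the materialized odd block is row 23 of `P_r + Σ μ ĉ ĉᵀ` (certificate C83X). [folklore] -/
theorem checkPmRowG1_23_weilCertDeflC83X : weilCertDeflC83XBase.checkPmRowG weilCertDeflC83XP weilCertDeflC83XPmO 1 23 = true := by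
  decide +kernel

set_option maxHeartbeats 0 in
/-- Row 24 of the materialized odd block is row 24 of `P_r + Σ μ ĉ ĉᵀ` (certificate C83X). [folklore] -/
theorem checkPmRowG1_24_weilCertDeflC83X : weilCertDeflC83XBase.checkPmRowG weilCertDeflC83XP weilCertDeflC83XPmO 1 24 = true := by
  decide +kernel

set_option maxHeartbeats 0 in
/-- Row 25 of the materialized odd block is row 25 of `P_r + Σ μ ĉ ĉᵀ` (certificate C83X). [folklore] -/
theorem checkPmRowG1_25_weilCertDeflC83X : weilCertDeflC83XBase.checkPmRowG weilCertDeflC83XP weilCertDeflC83XPmO 1 25 = true := by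
  decide +kernel

set_option maxHeartbeats 0 in
/-- Row 26 of the materialized odd block is row 26 of `P_r + Σ μ ĉ ĉᵀ` (certificate C83X). [folklore] -/
theorem checkPmRowG1_26_weilCertDeflC83X : weilCertDeflC83XBase.checkPmRowG weilCertDeflC83XP weilCertDeflC83XPmO 1 26 = true := by
  decide +kernel

set_option maxHeartbeats 0 in
/-- Row 27 of the materialized odd block is row 27 of `P_r + Σ μ ĉ ĉᵀ` (certificate C83X). [folklore] -/
theorem checkPmRowG1_27_weilCertDeflC83X : weilCertDeflC83XBase.checkPmRowG weilCertDeflC83XP weilCertDeflC83XPmO 1 27 = true := by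
  decide +kernel

set_option maxHeartbeats 0 in
/-- Row 28 of the materialized odd block is row 28 of `P_r + Σ μ ĉ ĉᵀ` (certificate C83X). [folklore] -/
theorem checkPmRowG1_28_weilCertDeflC83X : weilCertDeflC83XBase.checkPmRowG weilCertDeflC83XP weilCertDeflC83XPmO 1 28 = true := by
  decide +kernel

set_option maxHeartbeats 0 in
/-- Row 29 of the materialized odd block is row 29 of `P_r + Σ μ ĉ ĉᵀ` (certificate C83X). [folklore] -/
theorem checkPmRowG1_29_weilCertDeflC83X : weilCertDeflC83XBase.checkPmRowG weilCertDeflC83XP weilCertDeflC83XPmO 1 29 = true := by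
  decide +kernel

set_option maxHeartbeats 0 in
/-- Row 30 of the materialized odd block is row 30 of `P_r + Σ μ ĉ ĉᵀ` (certificate C83X). [folklore] -/
theorem checkPmRowG1_30_weilCertDeflC83X : weilCertDeflC83XBase.checkPmRowG weilCertDeflC83XP weilCertDeflC83XPmO 1 30 = true := by
  decide +kernel

set_option maxHeartbeats 0 in
/-- Row 31 of the materialized odd block is row 31 of `P_r + Σ μ ĉ ĉᵀ` (certificate C83X). [folklore] -/
theorem checkPmRowG1_31_weilCertDeflC83X : weilCertDeflC83XBase.checkPmRowG weilCertDeflC83XP weilCertDeflC83XPmO 1 31 = true := by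
  decide +kernel


end Summit.RiemannHypothesis.RiemannHypothesis.Theorems.EvenWinsBeyondArch
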